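import Summits.BirchSwinnertonDyer.BirchSwinnertonDyer.Theorems.AdditiveKolyvaginRoadKolyvaginPrimitiveAdditiveParityOfLevelInputs
import Literature.NumberTheory.EllipticCurves.SelmerPInftyGaloisAction
import Literature.NumberTheory.EllipticCurves.KramerShaIsogeny
import HarnessLib

/-!
# Route `AdditiveKolyvaginRoad`, crux `LevelKolyvaginSystemsAdditive` (item stmt-BirchSwinnertonDyer-21396, KS′):
# THE EIGEN-PARTS OF `Ш(E/K)[p]` UNDER COMPLEX CONJUGATION HAVE EVEN `𝔽_p`-DIMENSION
# — McCallum's splitting of the Cassels–Tate pairing along the eigenspaces of `Gal(K/ℚ)`, from the route's LEVELWISE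
# Cassels–Tate inputs (`casselsTate_levelInputs K` = conjunct 1 of `PublishedDualityInputsAdditiveKoly`)
# (cell `pub/bsd-wall`, width seat `bsd-wall-akr-p2x-w3` g4; `--supports stmt-BirchSwinnertonDyer-21396`, helper)

WHY. Every parity-forced step of the crux lines reads the `p`-Selmer group of `E/K` through the eigenspaces `Sel⁺ ⊕ Sel⁻` of
complex conjugation `c` (Gross 1991 (5.1); the carrier's `SelQP W K p c ∅ μ`). The tree knows the TOTAL parity
(`oddSelmerRankAdditive_of_levelInputs`: `#Sel_p(E/K) = p^s`, `s` odd; part 6 `odd_finrank_selQP_empty_of_published`) but not the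
parity BY SIGN — which is what (i) the transfer lines' (A1) stub needs (the three-Lagrangian switch `…LagrangianSwitchAtP` takes the
parities `p^a, p^b, a ≡ b (2)` as abstract inputs, and over `ℚ` the `p`-Selmer group of `E` is the `+`-part of `Sel_p(E/K)`, `p` odd),
and (ii) Kolyvagin's structure theorem reads (`r_p^{ε}` odd, `r_p^{−ε}` even; Kolyvagin 1991 Thm. 4, W. Zhang 2014 Thm. 11.2). The
sign-refined parity splits as `dim Sel^s = dim (E(K)/p)^s + dim Ш(E/K)[p]^s`; this file proves the `Ш`-half: **both eigen-parts of
`Ш(E/K)[p]` have even `𝔽_p`-dimension**, from the levelwise Cassels–Tate inputs, whose conjunct (v) is precisely the `c`-INVARIANCE of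
Milne's general-case pairing (Gross (5.1) equivariance, "used by McCallum 1991 §5, Thms. 5.4, 5.8 to split `Ш(E/K)_{p^∞}` and the
pairing along the eigenspaces of complex conjugation" — the fact's own docstring). The Selmer half is the sequel file.

WHAT (namespace `…Theorems.AdditiveKoly`).
* §1 `torsionH1ToH1_conjH1` ∕ `torsionH1ToH1_conjAct` — `H¹(K, E[n]) → H¹(K, E)` intertwines the actions of a lift `τ` of
  `σ ∈ Aut(K/ℚ)` (`conjH1` ∕ `conjAct` upstairs, `conjH1Points` downstairs): both composites are the map of one compatible pair.
* §2 `exists_mem_selmerGroup_torsionH1ToH1_eq` (every `n`-torsion class of `Ш` lifts to the `n`-Selmer group — AEC X.4.2(a), tree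
  `map_torsionH1ToH1_selmerGroup_holds`), `exists_two_mul_zsmul_eq_galH1Torsion` (`2` is invertible on `H¹(K, E[n])`, `n` odd),
  `exists_eigen_add_eigen_selmerGroup` (`Sel_n = Sel_n⁺ + Sel_n⁻` elementwise, `n` odd, `c² = 1`).
* §3 PURE ALGEBRA `natCard_torsionBy_eigen_eq_pow_two_mul` — a finite abelian group `G` killed by `p^k` (`p` odd) with an additive
  involution `τ` and a `τ`-INVARIANT non-degenerate alternating `B : G × G → ℚ/ℤ`: for `s = ±1`, `#{g : p g = 0, τ g = s g} = p^{2m}`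
  (opposite eigen-parts are `B`-orthogonal since `gcd(2, p^k) = 1`; `G = G⁺ + G⁻`; `B|_{G^s}` is non-degenerate alternating; tree
  `exists_natCard_torsionBy_eq_pow_two_mul`).
* §4 **`natCard_sha_torsion_eigen_eq_pow_two_mul`** — for `E = W/ℚ`, `K` imaginary quadratic, `p` odd, `c ≠ 1` (so `c² = 1`),
  `Ш(E/K)` finite and `casselsTate_levelInputs K`: for `s = ±1`,
  `#{y ∈ Ш(E/K) : p y = 0, τ' y = s y} = p^{2m}` where `τ' = conjH1Points` of the chosen lift of `c`. Road: a level `q = p^k` killing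
  `Ш[p^∞]` (as in akr-p1's `odd_selmerRank_of_rankOne_of_finiteSha_of_levelPairings_prime`); Milne's level pairing on `Ш[q]` is
  non-degenerate there (`nondegenerate_of_isLevelPairing`); every class of `Ш[q]` lifts to `Sel_{q²}` (§2), along which conjunct (v)
  transports to `B (τ' x) (τ' y) = B x y` and `conjAct² = 1` to `τ'² = 1` on `Ш[q]`; then §3.

HONEST FRAMING: theorems only; 0 definitions, 0 named facts, 0 `sorry`; CONDITIONAL on `casselsTate_levelInputs K` (published: Milne
ADT I §6 + Gross (5.1)) and the finiteness of `Ш(E/K)` (Kolyvagin, on the crux's frames); E-side; closes nothing. BSD is not proved by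
any of this.

References: [cite: McCallumLMS1991, §5, Thm. 5.4, Thm. 5.8] [cite: GrossLMS1991, §5 (5.1)] [cite: Kolyvagin1991MathAnn, §2 Thm. 4]
[cite: WZhang2014, Thm. 11.2 (i)] [cite: MilneADT2006, Ch. I §6, Prop. 6.9, Thm. 6.13(a)(b)] [cite: Cassels1962ArithmeticIV]
[cite: SilvermanAEC2009, Thm. X.4.2(a), Prop. III.8.1] [cite: SerreGaloisCohomology1997, I §2.4].
-/

-- single-conjunct summit: `Summit.BirchSwinnertonDyer.BirchSwinnertonDyer.…` repeats the name by design
set_option linter.dupNamespace false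

noncomputable section

open scoped Classical AddSubgroup

namespace Summit.BirchSwinnertonDyer.BirchSwinnertonDyer.Theorems.AdditiveKoly

open WeierstrassCurve NumberField IsDedekindDomain Field Literature.NumberTheory.EllipticCurves
  Literature.NumberTheory.GaloisRepresentations Literature.NumberTheory.GaloisCohomology
  Literature.GroupTheory.FiniteAbelian Module

/-! ## §1 `H¹(K, E[n]) → H¹(K, E)` intertwines the actions of `Aut(K/ℚ)` -/

section Compat

variable {K : Type} [Field K] [NumberField K] (W : WeierstrassCurve ℚ)

/-- **`H¹(K, E[n]) → H¹(K, E)` commutes with the action of a lift `τ` of `σ ∈ Aut(K/ℚ)`**: `ι_* ∘ τ_* = τ_* ∘ ι_*` for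
`ι : E[n] ↪ E(K̄)` — both composites are the map of the compatible pair `(g ↦ τ⁻¹ g τ, τ ∘ ι = ι ∘ τ)` (tree pattern
`primaryH1ToH1_conjH1Primary`, here at a finite level). [cite: GrossLMS1991, §5 (5.1)] [cite: SerreGaloisCohomology1997, I §2.4] -/
theorem torsionH1ToH1_conjH1 {σ : K ≃ₐ[ℚ] K} {τ : AlgebraicClosure K ≃+* AlgebraicClosure K}
    (hτ : IsLiftOfAut σ τ) (n : ℤ) (x : galH1Torsion (W.baseChange K) n) :
    torsionH1ToH1 (W.baseChange K) n (hτ.conjH1 W n x) = hτ.conjH1Points W (torsionH1ToH1 (W.baseChange K) n x) := by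
  change resH1Hom (ContinuousMonoidHom.id _) ((geomTorsion (W.baseChange K) n).subtype) (fun _ _ ↦ rfl)
      (resH1Hom hτ.conjGalCMH (hτ.torsionMap W n) (hτ.torsionMap_smul W n) x) =
    resH1Hom hτ.conjGalCMH (hτ.pointsMap W) (hτ.pointsMap_smul W)
      (resH1Hom (ContinuousMonoidHom.id _) ((geomTorsion (W.baseChange K) n).subtype) (fun _ _ ↦ rfl) x)
  rw [resH1Hom_resH1Hom, resH1Hom_resH1Hom]
  exact congrFun (congrArg DFunLike.coe (resH1Hom_congr (by ext; rfl) (by ext; rfl) _ _)) x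

/-- The same for the lift-independent action `conjAct W σ n` (computed by the chosen lift `liftAut σ`).
[cite: GrossLMS1991, §5 (5.1)] -/
theorem torsionH1ToH1_conjAct (σ : K ≃ₐ[ℚ] K) (n : ℤ) (x : galH1Torsion (W.baseChange K) n) :
    torsionH1ToH1 (W.baseChange K) n (conjAct W σ n x) =
      (isLiftOfAut_liftAut σ).conjH1Points W (torsionH1ToH1 (W.baseChange K) n x) :=
  torsionH1ToH1_conjH1 W (isLiftOfAut_liftAut σ) n x

end Compat

/-! ## §2 Lifting `Ш[n]` to the `n`-Selmer group; eigen-decomposition of Selmer classes -/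

section Lift

variable {K : Type} [Field K] [NumberField K] (W : WeierstrassCurve ℚ) [W.IsElliptic]

omit [W.IsElliptic] in
/-- **Every `n`-torsion class of `Ш(E/K)` lifts to the `n`-Selmer group** (`n ≠ 0`): `Sel^{(n)} ↠ Ш[n]` (AEC X.4.2(a); tree
`map_torsionH1ToH1_selmerGroup_holds`). [cite: SilvermanAEC2009, Thm. X.4.2(a)] -/
theorem exists_mem_selmerGroup_torsionH1ToH1_eq {n : ℕ} (hn : n ≠ 0) {y : (W.baseChange K).galH1}
    (hy : y ∈ (W.baseChange K).sha) (hny : (n : ℤ) • y = 0) :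
    ∃ z ∈ selmerGroup (W.baseChange K) (n : ℤ), torsionH1ToH1 (W.baseChange K) (n : ℤ) z = y := by
  have hn' : ((n : ℕ) : ℤ) ≠ 0 := Int.natCast_ne_zero.mpr hn
  have hmem : y ∈ (W.baseChange K).sha ⊓ AddSubgroup.torsionBy (W.baseChange K).galH1 (n : ℤ) :=
    AddSubgroup.mem_inf.mpr ⟨hy, AddSubgroup.torsionBy.nsmul_iff.mpr (by rw [← natCast_zsmul]; exact hny)⟩
  rw [← WeierstrassCurve.map_torsionH1ToH1_selmerGroup_holds (W.baseChange K) hn'] at hmem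
  exact AddSubgroup.mem_map.mp hmem

omit [W.IsElliptic] in
/-- On `H¹(K, E[n])` with `n` odd, `2` is invertible: `(2u) • x = x` for `2u = n + 1`. [folklore] -/
theorem exists_two_mul_zsmul_eq_galH1Torsion {n : ℕ} (hn : Odd n) :
    ∃ u : ℤ, ∀ x : galH1Torsion (W.baseChange K) (n : ℤ), (2 * u) • x = x := by
  obtain ⟨j, hj⟩ := hn
  refine ⟨(j : ℤ) + 1, fun x ↦ ?_⟩
  have h1 : (2 * ((j : ℤ) + 1)) = (n : ℤ) + 1 := by rw [hj]; push_cast; ring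
  rw [h1, add_zsmul, one_zsmul, zsmul_galH1Torsion_eq_zero, zero_add]

omit [W.IsElliptic] in
/-- **Eigen-decomposition of Selmer classes** (`n` odd, `K` imaginary quadratic, `c² = 1`): every `t ∈ Sel^{(n)}(E/K)` is `t₁ + t₂`
with `t₁, t₂ ∈ Sel^{(n)}`, `c t₁ = t₁`, `c t₂ = −t₂` (`t₁ = u(t + ct)`, `t₂ = u(t − ct)`, `2u ≡ 1`; the Selmer group is `Aut(K/ℚ)`-stable,
tree `conjAct_mem_selmerGroup`). [cite: GrossLMS1991, §5 (5.1)] -/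
theorem exists_eigen_add_eigen_selmerGroup (hK : IsImaginaryQuadratic K) (c : K ≃ₐ[ℚ] K) (hcc : c * c = 1)
    {n : ℕ} (hn : Odd n) {t : galH1Torsion (W.baseChange K) (n : ℤ)}
    (ht : t ∈ selmerGroup (W.baseChange K) (n : ℤ)) :
    ∃ t₁ ∈ selmerGroup (W.baseChange K) (n : ℤ), ∃ t₂ ∈ selmerGroup (W.baseChange K) (n : ℤ),
      t = t₁ + t₂ ∧ conjAct W c (n : ℤ) t₁ = t₁ ∧ conjAct W c (n : ℤ) t₂ = -t₂ := by
  obtain ⟨u, hu⟩ := exists_two_mul_zsmul_eq_galH1Torsion (K := K) W hn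
  set τ := conjAct W c (n : ℤ) with hτ
  have hct : τ t ∈ selmerGroup (W.baseChange K) (n : ℤ) := conjAct_mem_selmerGroup W (fun w ↦ hK.2.isComplex w) c _ ht
  have hττ : ∀ x, τ (τ x) = x := conjAct_conjAct_of_mul_self W hcc (n : ℤ)
  refine ⟨u • (t + τ t), AddSubgroup.zsmul_mem _ (AddSubgroup.add_mem _ ht hct) u,
    u • (t - τ t), AddSubgroup.zsmul_mem _ (AddSubgroup.sub_mem _ ht hct) u, ?_, ?_, ?_⟩
  · have : u • (t + τ t) + u • (t - τ t) = (2 * u) • t := by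
      rw [← zsmul_add, show t + τ t + (t - τ t) = t + t by abel, ← two_zsmul, smul_smul, mul_comm]
    rw [this, hu t]
  · rw [map_zsmul, map_add, hττ, add_comm]
  · rw [map_zsmul, map_sub, hττ, ← neg_sub t (τ t), zsmul_neg]

end Lift

/-! ## §3 Pure algebra: eigen-parts of an invariant non-degenerate alternating pairing on a `p`-group -/

section Algebra

/-- **Eigen-parts of an invariant non-degenerate alternating pairing have even `p`-rank.** Let `G` be a finite abelian group
killed by `p ^ k` (`p` odd), `τ` an additive involution of `G`, and `B : G × G → ℚ/ℤ` bi-additive, alternating, non-degenerate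
and `τ`-INVARIANT (`B (τ x) (τ y) = B x y`). Then for `s = ±1` the `s`-eigen-part `G^s = {τ g = s g}` has `#G^s[p] = p^{2m}`:
opposite eigen-parts are `B`-orthogonal (`B x y = B (τx) (τy) = -B x y`, and `2`, `p^k` are coprime), `G = G⁺ + G⁻` (`2` is
invertible modulo `p^k`), so `B` restricts to a non-degenerate alternating pairing on `G^s`, whose `p`-torsion has even rank
(tree `exists_natCard_torsionBy_eq_pow_two_mul`). [cite: McCallumLMS1991, §5 (Thm. 5.4, Thm. 5.8)] [cite: GrossLMS1991, §5 (5.1)] -/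
theorem natCard_torsionBy_eigen_eq_pow_two_mul {G : Type*} [AddCommGroup G] [Finite G] {p k : ℕ} [hp : Fact p.Prime]
    (hp2 : p ≠ 2) (hG : ∀ g : G, p ^ k • g = 0) (τ : G →+ G) (hττ : ∀ g, τ (τ g) = g)
    (B : G →+ G →+ AddCircle (1 : ℚ)) (halt : ∀ x, B x x = 0) (hnd : ∀ x, (∀ y, B x y = 0) → x = 0)
    (hBτ : ∀ x y, B (τ x) (τ y) = B x y) (s : ℤ) (hs : s = 1 ∨ s = -1) :
    ∃ m : ℕ, Nat.card {g : G // (p : ℤ) • g = 0 ∧ τ g = s • g} = p ^ (2 * m) := by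
  have hpp : p.Prime := hp.out
  -- `2` is invertible on `G`
  obtain ⟨u, hu⟩ : ∃ u : ℤ, ∀ g : G, (2 * u) • g = g := by
    obtain ⟨j, hj⟩ := ((hpp.odd_of_ne_two hp2).pow (n := k))
    refine ⟨(j : ℤ) + 1, fun g ↦ ?_⟩
    have h1 : (2 * ((j : ℤ) + 1)) = ((p ^ k : ℕ) : ℤ) + 1 := by rw [hj]; push_cast; ring
    rw [h1, add_zsmul, one_zsmul, natCast_zsmul, hG, zero_add]
  have hcop : (2 : ℕ).Coprime (p ^ k) := (Nat.coprime_two_left.mpr (hpp.odd_of_ne_two hp2)).pow_right k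
  have hBq : ∀ x y : G, (p ^ k) • B x y = 0 := fun x y ↦ by
    rw [← AddMonoidHom.nsmul_apply, ← map_nsmul, hG, map_zero, AddMonoidHom.zero_apply]
  -- ORTHOGONALITY of opposite eigen-classes
  have horth : ∀ (s₀ : ℤ), s₀ * s₀ = 1 → ∀ x y : G, τ x = s₀ • x → τ y = -s₀ • y → B x y = 0 := by
    intro s₀ hs₀ x y hx hy
    have h := hBτ x y
    rw [hx, hy] at h
    rw [map_zsmul, map_zsmul, AddMonoidHom.zsmul_apply, smul_smul, neg_mul, hs₀, neg_one_zsmul] at h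
    -- `h : -B x y = B x y`, so `2 • B x y = 0`
    have h2 : 2 • B x y = 0 := by rw [two_nsmul]; nth_rw 1 [← h]; exact neg_add_cancel (B x y)
    exact eq_zero_of_nsmul_eq_zero_of_coprime hcop h2 (hBq x y)
  -- DECOMPOSITION into eigen-classes
  have hdec : ∀ g : G, ∃ g₁ g₂ : G, g = g₁ + g₂ ∧ τ g₁ = g₁ ∧ τ g₂ = -g₂ := fun g ↦ by
    refine ⟨u • (g + τ g), u • (g - τ g), ?_, ?_, ?_⟩
    · have : u • (g + τ g) + u • (g - τ g) = (2 * u) • g := by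
        rw [← zsmul_add, show g + τ g + (g - τ g) = g + g by abel, ← two_zsmul, smul_smul, mul_comm]
      rw [this, hu g]
    · rw [map_zsmul, map_add, hττ, add_comm]
    · rw [map_zsmul, map_sub, hττ, ← neg_sub g (τ g), zsmul_neg]
  -- the `s`-eigen-part and the restricted pairing
  set A : AddSubgroup G := (τ - s • AddMonoidHom.id G).ker with hAdef
  have memA : ∀ x, x ∈ A ↔ τ x = s • x := fun x ↦ by
    rw [hAdef, AddMonoidHom.mem_ker, AddMonoidHom.sub_apply, AddMonoidHom.zsmul_apply, AddMonoidHom.id_apply, sub_eq_zero]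
  let BA : A →+ A →+ AddCircle (1 : ℚ) := (B.comp A.subtype).compl₂ A.subtype
  have hBA : ∀ a b : A, BA a b = B (a : G) b := fun a b ↦ rfl
  have haltA : ∀ a : A, BA a a = 0 := fun a ↦ by rw [hBA]; exact halt _
  have hndA : ∀ a : A, (∀ b : A, BA a b = 0) → a = 0 := by
    intro a ha
    apply Subtype.ext
    apply hnd
    intro y
    obtain ⟨y₁, y₂, rfl, hy₁, hy₂⟩ := hdec y
    rw [map_add]
    have haτ : τ (a : G) = s • (a : G) := (memA _).mp a.2
    rcases hs with rfl | rfl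
    · have h1 : B (a : G) y₁ = 0 := by
        have := ha ⟨y₁, (memA y₁).mpr (by rw [hy₁, one_zsmul])⟩
        rwa [hBA] at this
      have h2 : B (a : G) y₂ = 0 := horth 1 (by norm_num) _ _ haτ (by rw [hy₂, neg_one_zsmul])
      rw [h1, h2, add_zero]
    · have h1 : B (a : G) y₂ = 0 := by
        have := ha ⟨y₂, (memA y₂).mpr (by rw [hy₂, neg_one_zsmul])⟩
        rwa [hBA] at this
      have h2 : B (a : G) y₁ = 0 := horth (-1) (by norm_num) _ _ haτ (by rw [hy₁, neg_neg, one_zsmul])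
      rw [h1, h2, zero_add]
  -- `A` is a finite `p`-group with a non-degenerate alternating pairing
  have hQ : ∀ a : A, ∃ n : ℕ, p ^ n • a = 0 := fun a ↦
    ⟨k, Subtype.ext (by rw [AddSubgroup.coe_nsmul, ZeroMemClass.coe_zero]; exact hG _)⟩
  obtain ⟨m, hm⟩ := Literature.Algebra.Module.exists_natCard_torsionBy_eq_pow_two_mul (p := p) hQ BA haltA hndA
  refine ⟨m, ?_⟩
  rw [← hm]
  -- `{g : p g = 0, τ g = s g} ≃ A[p]`
  refine Nat.card_congr
    { toFun := fun g ↦ ⟨⟨g.1, (memA _).mpr g.2.2⟩, (Submodule.mem_torsionBy_iff _ _).mpr (Subtype.ext g.2.1)⟩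
      invFun := fun a ↦ ⟨((a : A) : G), ?_, (memA _).mp (a : A).2⟩
      left_inv := fun g ↦ rfl
      right_inv := fun a ↦ rfl }
  have h := (Submodule.mem_torsionBy_iff _ _).mp a.2
  exact congrArg Subtype.val h

end Algebra

/-! ## §4 The eigen-parts of `Ш(E/K)[p]` under complex conjugation have EVEN `𝔽_p`-dimension -/

section ShaEigen

variable {K : Type} [Field K] [NumberField K] (W : WeierstrassCurve ℚ) [W.IsElliptic]

set_option maxHeartbeats 400000 in
/-- **THE EIGEN-PARTS OF `Ш(E/K)[p]` HAVE EVEN `𝔽_p`-DIMENSION.** For `E = W/ℚ`, `K` imaginary quadratic, `p` an odd prime,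
`c ∈ Aut(K/ℚ)`, `c ≠ 1`, `c² = 1`, `Ш(E/K)` finite, and the levelwise Cassels–Tate inputs `casselsTate_levelInputs K` (conjunct 1 of
`PublishedDualityInputsAdditiveKoly`): for `s = ±1`, `#{y ∈ Ш(E/K) : p y = 0, c y = s y} = p^{2m}` for some `m`, the action of `c` on
`H¹(K, E)` being `conjH1Points` of the chosen lift `liftAut c`. Proof: at a level `q = p^k` killing `Ш[p^∞]` Milne's level pairing
`B` on `Ш[q]` is non-degenerate (`nondegenerate_of_isLevelPairing`); every class of `Ш[q]` lifts to `Sel^{(q²)}` (§2), so conjunct (v)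
of the inputs (invariance of the general-case pairing under `c` on `Sel^{(q²)}`) gives `B (c x) (c y) = B x y` and `conjAct² = 1`
gives `c² = 1` on `Ш[q]` (§1); conclude by the pure algebra of §3. This is McCallum's eigenspace splitting of `Ш(E/K)_{p^∞}` and of
the Cassels–Tate pairing. [cite: McCallumLMS1991, §5, Thm. 5.4, Thm. 5.8] [cite: GrossLMS1991, §5 (5.1)]
[cite: MilneADT2006, Ch. I §6, Prop. 6.9, Thm. 6.13(a)] [cite: SilvermanAEC2009, Thm. X.4.2(a), Prop. III.8.1] -/
theorem natCard_sha_torsion_eigen_eq_pow_two_mul (hCT : casselsTate_levelInputs K) (hK : IsImaginaryQuadratic K)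
    (p : ℕ) [hp : Fact p.Prime] (hp2 : p ≠ 2) (c : K ≃ₐ[ℚ] K) (hc1 : c ≠ 1) (hcc : c * c = 1)
    (hSha : Finite (W.baseChange K).sha) (s : ℤ) (hs : s = 1 ∨ s = -1) :
    ∃ m : ℕ, Nat.card {y : (W.baseChange K).galH1 // y ∈ (W.baseChange K).sha ∧ (p : ℤ) • y = 0 ∧
        (isLiftOfAut_liftAut c).conjH1Points W y = s • y} = p ^ (2 * m) := by
  have hpp : p.Prime := hp.out
  haveI := hSha
  set V := W.baseChange K with hV
  set τ' := (isLiftOfAut_liftAut c).conjH1Points W with hτ'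
  -- a level `q = p^k`, `k ≥ 1`, killing the `p`-primary part of the finite group `Ш`
  set k : ℕ := padicValNat p (Nat.card V.sha) + 1 with hkdef
  have hkpos : 0 < k := Nat.succ_pos _
  have hcard0 : Nat.card V.sha ≠ 0 := Nat.card_pos.ne'
  have hkill : ∀ z : V.sha, (∃ j : ℕ, p ^ j • z = 0) → p ^ k • z = 0 := by
    rintro z ⟨j, hj⟩
    have hdvd : addOrderOf z ∣ p ^ j := addOrderOf_dvd_iff_nsmul_eq_zero.mpr hj
    obtain ⟨a, -, ha⟩ := (Nat.dvd_prime_pow hpp).mp hdvd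
    have han : p ^ a ∣ Nat.card V.sha := ha ▸ addOrderOf_dvd_natCard z
    have hale : a ≤ padicValNat p (Nat.card V.sha) := (padicValNat_dvd_iff_le hcard0).mp han
    have hak : addOrderOf z ∣ p ^ k := by
      rw [ha]
      exact pow_dvd_pow p (by omega)
    exact addOrderOf_dvd_iff_nsmul_eq_zero.mp hak
  have hq : ∀ z : V.sha, (p ^ k * p ^ k) • z = 0 → p ^ k • z = 0 := fun z hz ↦
    hkill z ⟨k + k, by rwa [pow_add]⟩
  -- the levelwise Cassels–Tate inputs at `q = p^k`, fed the Weil pairing on `E[q²]` and the conjugation `c`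
  haveI : NeZero (p ^ k) := ⟨pow_ne_zero _ hpp.ne_zero⟩
  have h2 : 2 ≤ p ^ k * p ^ k :=
    le_trans (le_trans hpp.two_le (Nat.le_self_pow hkpos.ne' p)) (Nat.le_mul_of_pos_right _ (NeZero.pos (p ^ k)))
  have hqK : ((p ^ k * p ^ k : ℕ) : K) ≠ 0 := Nat.cast_ne_zero.mpr (NeZero.ne (p ^ k * p ^ k))
  obtain ⟨e, hμ, hadd₁, hadd₂, halt, hnde, hgal⟩ := exists_weilPairing_holds V (p ^ k * p ^ k) h2 hqK
  obtain ⟨inv, hPT', hH3, -, hB, hinv⟩ := hCT W p k hpp hp2 hkpos c hc1 hcc e hμ hadd₁ hadd₂ hgal halt hnde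
  -- name the pairing `B` and the ambient group `G = Ш[q]`
  obtain ⟨B, hBlev, hBapply⟩ : ∃ B : (V.sha)[((p ^ k : ℕ) : ℤ)] →+ (V.sha)[((p ^ k : ℕ) : ℤ)] →+ AddCircle (1 : ℚ),
      IsLevelPairing (p ^ k) B ∧ ∀ x y, B x y = zmodToCircle (p ^ k * p ^ k)
        (ctGeneralFun V (p ^ k) e hμ hadd₁ hadd₂ hgal inv ((x : V.sha) : V.galH1) ((y : V.sha) : V.galH1)) :=
    ⟨_, hB, fun x y ↦ rfl⟩
  clear hB
  have hnd : ∀ x : (V.sha)[((p ^ k : ℕ) : ℤ)], (∀ y, B x y = 0) → x = 0 := nondegenerate_of_isLevelPairing hBlev hq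
  -- the coordinate `f : Ш[q] → H¹(K, E)` and its basic properties
  set f : (V.sha)[((p ^ k : ℕ) : ℤ)] →+ V.galH1 := V.sha.subtype.comp ((V.sha)[((p ^ k : ℕ) : ℤ)]).subtype with hfdef
  have hf : ∀ x, f x = ((x : V.sha) : V.galH1) := fun _ ↦ rfl
  have hf_inj : Function.Injective f := fun x y h ↦ Subtype.ext (Subtype.ext h)
  have hf_sha : ∀ x, f x ∈ V.sha := fun x ↦ (x : V.sha).2
  have hf_q : ∀ x, (p ^ k) • f x = 0 := fun x ↦ by rw [← map_nsmul, AddSubgroup.torsionBy.nsmul x, map_zero]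
  -- the square level `N = q²`, the map `ρ : H¹(K, E[N]) → H¹(K, E)` and the Selmer lifts of `Ш[q]`
  set N : ℕ := p ^ k * p ^ k with hNdef
  have hN0 : N ≠ 0 := NeZero.ne (p ^ k * p ^ k)
  have hNodd : Odd N := (hpp.odd_of_ne_two hp2).pow.mul (hpp.odd_of_ne_two hp2).pow
  set ρ := torsionH1ToH1 V (N : ℤ) with hρ
  have hρc : ∀ z, ρ (conjAct W c (N : ℤ) z) = τ' (ρ z) := fun z ↦ torsionH1ToH1_conjAct W c (N : ℤ) z
  have hρ_sha : ∀ {z}, z ∈ selmerGroup V (N : ℤ) → ρ z ∈ V.sha := fun {z} hz ↦ by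
    have hmem : ρ z ∈ (selmerGroup V (N : ℤ)).map ρ := AddSubgroup.mem_map_of_mem _ hz
    rw [WeierstrassCurve.map_torsionH1ToH1_selmerGroup_holds V (Int.natCast_ne_zero.mpr hN0)] at hmem
    exact (AddSubgroup.mem_inf.mp hmem).1
  have hlift : ∀ x : (V.sha)[((p ^ k : ℕ) : ℤ)], ∃ z ∈ selmerGroup V (N : ℤ), ρ z = f x := fun x ↦
    exists_mem_selmerGroup_torsionH1ToH1_eq W hN0 (hf_sha x)
      (by rw [natCast_zsmul, hNdef, mul_comm, mul_nsmul, hf_q, nsmul_zero])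
  have hcstab : ∀ {z}, z ∈ selmerGroup V (N : ℤ) → conjAct W c (N : ℤ) z ∈ selmerGroup V (N : ℤ) :=
    fun {z} hz ↦ conjAct_mem_selmerGroup W (fun w ↦ hK.2.isComplex w) c _ hz
  -- `τ'` restricts to an additive involution `τG` of `G = Ш[q]`
  have hτ'_mem : ∀ x, τ' (f x) ∈ V.sha := fun x ↦ by
    obtain ⟨z, hz, hzx⟩ := hlift x
    rw [← hzx, ← hρc]
    exact hρ_sha (hcstab hz)
  have hτ'_tor : ∀ x, (p ^ k) • τ' (f x) = 0 := fun x ↦ by rw [← map_nsmul, hf_q, map_zero]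
  let τG₀ : (V.sha)[((p ^ k : ℕ) : ℤ)] → (V.sha)[((p ^ k : ℕ) : ℤ)] := fun x ↦
    ⟨⟨τ' (f x), hτ'_mem x⟩, AddSubgroup.torsionBy.nsmul_iff.mpr
      (Subtype.ext (by rw [AddSubgroup.coe_nsmul, ZeroMemClass.coe_zero]; exact hτ'_tor x))⟩
  have hτG₀ : ∀ x, f (τG₀ x) = τ' (f x) := fun _ ↦ rfl
  let τG : (V.sha)[((p ^ k : ℕ) : ℤ)] →+ (V.sha)[((p ^ k : ℕ) : ℤ)] :=
    AddMonoidHom.mk' τG₀ fun x y ↦ hf_inj (by rw [map_add, hτG₀, hτG₀, hτG₀, map_add, map_add])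
  have hτG : ∀ x, f (τG x) = τ' (f x) := fun _ ↦ rfl
  have hττ : ∀ x, τG (τG x) = x := fun x ↦ by
    apply hf_inj
    obtain ⟨z, hz, hzx⟩ := hlift x
    rw [hτG, hτG, ← hzx, ← hρc, ← hρc, conjAct_conjAct_of_mul_self W hcc]
  -- INVARIANCE of the level pairing under `τG` (Gross (5.1) equivariance, input (v) of `casselsTate_levelInputs`)
  have hBτ : ∀ x y, B (τG x) (τG y) = B x y := by
    intro x y
    obtain ⟨z, hz, hzx⟩ := hlift x
    obtain ⟨t, ht, hty⟩ := hlift y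
    have h := hinv z hz t ht
    rw [hBapply, hBapply, ← hf, ← hf, ← hf, ← hf, hτG, hτG, ← hzx, ← hty, ← hρc, ← hρc]
    exact congrArg _ h
  have hG : ∀ g : (V.sha)[((p ^ k : ℕ) : ℤ)], p ^ k • g = 0 := fun g ↦ AddSubgroup.torsionBy.nsmul g
  -- pure algebra
  obtain ⟨m, hm⟩ := natCard_torsionBy_eigen_eq_pow_two_mul hp2 hG τG hττ B hBlev.1 hnd hBτ s hs
  refine ⟨m, ?_⟩
  rw [← hm]
  -- `{y ∈ Ш : p y = 0, τ' y = s y} ≃ {g ∈ Ш[q] : p g = 0, τG g = s g}`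
  have hpk : (p : ℤ) ∣ ((p ^ k : ℕ) : ℤ) := by exact_mod_cast dvd_pow_self p hkpos.ne'
  refine Nat.card_congr
    { toFun := fun y ↦ ⟨⟨⟨y.1, y.2.1⟩, AddSubgroup.torsionBy.nsmul_iff.mpr (Subtype.ext ?_)⟩, ?_, ?_⟩
      invFun := fun g ↦ ⟨f g.1, hf_sha g.1, ?_, ?_⟩
      left_inv := fun y ↦ rfl
      right_inv := fun g ↦ rfl }
  · -- `q • y = 0` from `p • y = 0`
    obtain ⟨d, hd⟩ := hpk
    rw [AddSubgroup.coe_nsmul, ZeroMemClass.coe_zero, ← natCast_zsmul, hd, mul_comm, mul_zsmul, y.2.2.1, zsmul_zero]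
  · exact hf_inj (by rw [map_zsmul, map_zero]; exact y.2.2.1)
  · exact hf_inj (by rw [hτG, map_zsmul]; exact y.2.2.2)
  · have h := congrArg f g.2.1
    rwa [map_zsmul, map_zero] at h
  · have h := congrArg f g.2.2
    rwa [hτG, map_zsmul] at h

end ShaEigen

end Summit.BirchSwinnertonDyer.BirchSwinnertonDyer.Theorems.AdditiveKoly

end
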